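import Summits.FinalStateConjecture.FinalStateConjecture.Theorems.PhotonSphereChannelsExteriorEnergyRW
import Summits.FinalStateConjecture.FinalStateConjecture.Theorems.WindowedShellChannels.Negative.LaggedApertures

/-!
# Crux `WindowedShellChannels` (stmt-FinalStateConjecture-14085), line `SketchIdeator3` — stub `stub_duality`

**Completion duality for two finite-energy solutions** `a`, `j` of `ψ_tt − ψ_xx + Vψ = 0`, `V ≥ 0`
differentiable: if the energy pairing of `a` and `j` at `t = 0` equals `E(j)`, `E(a) ≤ A·E(j)`, and
`a` keeps all but `θ²E(j)` of its energy ahead of the (possibly lagged, `b < 0`) forward cone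
`{b + |t| < |x|}`, then `j` radiates at least `((1 − θ)²/A)·E(j)` through the same cone.

Proof (sub-namespace `Duality`): the pointwise polarisation inequality `2μ·p ≤ μ² e[a] + e[j]`
(`p = a_t j_t + a_x j_x + V a j`, all real `μ`) integrates on any set `S` to
`∫_S p ≤ √(∫_S e[a])·√(∫_S e[j])` (discriminant); `∫ p(t, ·)` is conserved since
`e[a + j] = e[a] + e[j] + 2p` and the total energies of `a`, `j`, `a + j` are conserved (copy of
`RW.totalEnergy_eq_totalEnergy`, whose module is not in the current farm build); at every time
`t ≥ max 0 (−b)`, `E(j) = ∫_out p + ∫_in p ≤ √(E(a)·Q_t(j)) + √(P_t(a)·E(j))`, `Q_t`/`P_t` the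
energies outside/inside the cone, `P_t(a) ≤ θ²E(j)`, whence `((1 − θ)²/A)·E(j) ≤ Q_t(j)`; finally
`liminf_{t → +∞}`.  No definitions. [folklore]
-/

noncomputable section

set_option linter.dupNamespace false

namespace Summit.FinalStateConjecture.FinalStateConjecture.Theorems.WindowedShellChannelsStubs

open Literature.Geometry.Lorentzian Literature.Geometry.Lorentzian.ReggeWheeler
open Filter Set MeasureTheory
open scoped ENNReal Topology

namespace Duality

variable {V : ℝ → ℝ} {ψ a j : ℝ → ℝ → ℝ}

/-- Private copy of `RW.energyDensity_he` (farm build gap). [folklore] -/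
private theorem energyDensity_he (hψ : ContDiff ℝ 2 (Function.uncurry ψ)) :
    ∀ z : ℝ × ℝ, (fun z : ℝ × ℝ => energyDensity V ψ z.1 z.2) z
      = (fderiv ℝ (Function.uncurry ψ) z (1, 0)) ^ 2 + (fderiv ℝ (Function.uncurry ψ) z (0, 1)) ^ 2
        + V z.2 * Function.uncurry ψ z ^ 2 := by
  rintro ⟨t, x⟩
  simp only [Function.uncurry_apply_pair, energyDensity]
  rw [WaveEnergy.deriv_slice_fst_eq hψ, WaveEnergy.deriv_slice_snd_eq hψ]

/-- The energy density at a fixed time is continuous (copy of `RW.continuous_energyDensity_slice`,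
farm build gap). [folklore] -/
theorem continuous_energyDensity_slice (hV : Differentiable ℝ V)
    (hψ : ContDiff ℝ 2 (Function.uncurry ψ)) (t : ℝ) :
    Continuous (fun x => energyDensity V ψ t x) :=
  (WaveEnergy.continuous_energyDensity hψ hV (energyDensity_he hψ)).comp (Continuous.prodMk_right t)

/-- Private copy of `RW.totalEnergy_le_totalEnergy` (with `RW.IsSolution.fderiv_eq`,
`RW.totalEnergy_eq_iSup_Ioi`, `RW.setLIntegral_Ioi_energy_le_totalEnergy` inlined; farm build gap):
exhaust the line by half-lines `(−n, ∞)` and use the domain of dependence. [folklore] -/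
private theorem totalEnergy_le_totalEnergy (hV : Differentiable ℝ V) (hV0 : ∀ x, 0 ≤ V x)
    (hψ : IsSolution V ψ) (t₁ t₂ : ℝ) : totalEnergy V ψ t₁ ≤ totalEnergy V ψ t₂ := by
  have he := energyDensity_he (V := V) hψ.1
  have hsol : ∀ z : ℝ × ℝ, fderiv ℝ (fderiv ℝ (Function.uncurry ψ)) z (1, 0) (1, 0)
      - fderiv ℝ (fderiv ℝ (Function.uncurry ψ)) z (0, 1) (0, 1)
      + V z.2 * Function.uncurry ψ z = 0 := by
    rintro ⟨t, x⟩
    rw [← WaveEnergy.iteratedDeriv_two_slice_fst_eq hψ.1,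
      ← WaveEnergy.iteratedDeriv_two_slice_snd_eq hψ.1]
    exact hψ.2 (t, x)
  have hsup : totalEnergy V ψ t₁
      = ⨆ n : ℕ, ∫⁻ x in Ioi (-(n : ℝ)), ENNReal.ofReal (energyDensity V ψ t₁ x) := by
    have hdir : Directed (· ⊆ ·) (fun n : ℕ => Ioi (-(n : ℝ))) :=
      Monotone.directed_le fun i j hij => Ioi_subset_Ioi (neg_le_neg (Nat.cast_le.mpr hij))
    have hU : (⋃ n : ℕ, Ioi (-(n : ℝ))) = univ := by
      refine eq_univ_of_forall fun x => ?_
      obtain ⟨n, hn⟩ := exists_nat_gt (-x)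
      exact mem_iUnion.2 ⟨n, by simp only [mem_Ioi]; linarith⟩
    unfold totalEnergy
    rw [← setLIntegral_univ, ← hU, setLIntegral_iUnion_of_directed _ hdir]
  rw [hsup]
  refine iSup_le fun n => ?_
  rcases le_total t₁ t₂ with h | h
  · exact (WaveEnergy.lintegral_Ioi_le_expanding hψ.1 hV hV0 hsol he _ h).trans
      (setLIntegral_le_lintegral _ _)
  · have key := WaveEnergy.lintegral_Ioi_shrinking_le hψ.1 hV hV0 hsol he (-(n : ℝ) - (t₁ - t₂)) h
    rw [show -(n : ℝ) - (t₁ - t₂) + (t₁ - t₂) = -(n : ℝ) by ring] at key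
    exact key.trans (setLIntegral_le_lintegral _ _)

/-- **Conservation of the total energy** of a global `C²` solution (`V ≥ 0` differentiable), in
`[0, ∞]`; private copy of `RW.totalEnergy_eq_totalEnergy` (farm build gap). [folklore] -/
private theorem totalEnergy_eq_totalEnergy (hV : Differentiable ℝ V) (hV0 : ∀ x, 0 ≤ V x)
    (hψ : IsSolution V ψ) (t₁ t₂ : ℝ) : totalEnergy V ψ t₁ = totalEnergy V ψ t₂ :=
  le_antisymm (totalEnergy_le_totalEnergy hV hV0 hψ t₁ t₂)
    (totalEnergy_le_totalEnergy hV hV0 hψ t₂ t₁)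

/-- `t`-slices of a `C²` function are `C²` (cf. `CauchyWaveGlobal.contDiff_slice_fst`). [folklore] -/
private theorem contDiff_slice_fst (h : ContDiff ℝ 2 (Function.uncurry ψ)) (x : ℝ) :
    ContDiff ℝ 2 (fun τ => ψ τ x) :=
  h.comp (contDiff_id.prodMk contDiff_const)

/-- `x`-slices of a `C²` function are `C²` (cf. `CauchyWaveGlobal.contDiff_slice_snd`). [folklore] -/
private theorem contDiff_slice_snd (h : ContDiff ℝ 2 (Function.uncurry ψ)) (t : ℝ) :
    ContDiff ℝ 2 (ψ t) :=
  h.comp (contDiff_const.prodMk contDiff_id)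

/-- **Linearity**: the sum of two global classical solutions is a global classical solution.
[folklore] -/
theorem isSolution_add (ha : IsSolution V a) (hj : IsSolution V j) :
    IsSolution V (fun t x => a t x + j t x) := by
  refine ⟨ha.1.add hj.1, fun ⟨t, x⟩ => ?_⟩
  have e₁ := ha.2 (t, x)
  have e₂ := hj.2 (t, x)
  unfold IsSolutionAt at e₁ e₂ ⊢
  simp only at e₁ e₂ ⊢
  rw [iteratedDeriv_fun_add (contDiff_slice_fst ha.1 x).contDiffAt
      (contDiff_slice_fst hj.1 x).contDiffAt,
    iteratedDeriv_fun_add (contDiff_slice_snd ha.1 t).contDiffAt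
      (contDiff_slice_snd hj.1 t).contDiffAt]
  linear_combination e₁ + e₂

/-- **Polarisation**: `e[a + j] = e[a] + e[j] + 2·(a_t j_t + a_x j_x + V a j)`. [folklore] -/
theorem energyDensity_add (ha : ContDiff ℝ 2 (Function.uncurry a))
    (hj : ContDiff ℝ 2 (Function.uncurry j)) (t x : ℝ) :
    energyDensity V (fun t x => a t x + j t x) t x
      = energyDensity V a t x + energyDensity V j t x
        + 2 * (deriv (fun τ => a τ x) t * deriv (fun τ => j τ x) t + deriv (a t) x * deriv (j t) x
            + V x * (a t x * j t x)) := by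
  have d₁ := fun (φ : ℝ → ℝ → ℝ) (h : ContDiff ℝ 2 (Function.uncurry φ)) =>
    ((contDiff_slice_fst h x).differentiable (by norm_num)) t
  have d₂ := fun (φ : ℝ → ℝ → ℝ) (h : ContDiff ℝ 2 (Function.uncurry φ)) =>
    ((contDiff_slice_snd h t).differentiable (by norm_num)) x
  simp only [energyDensity]
  rw [deriv_fun_add (d₁ a ha) (d₁ j hj), deriv_fun_add (d₂ a ha) (d₂ j hj)]
  ring

/-- **Weighted polarisation inequality** (pointwise Cauchy–Schwarz): for every real `μ`,
`2μ·(a_t j_t + a_x j_x + V a j) ≤ μ² e[a] + e[j]` wherever `V ≥ 0`. [folklore] -/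
theorem pairing_amgm (hV0 : ∀ x, 0 ≤ V x) (a j : ℝ → ℝ → ℝ) (t μ x : ℝ) :
    2 * μ * (deriv (fun τ => a τ x) t * deriv (fun τ => j τ x) t + deriv (a t) x * deriv (j t) x
        + V x * (a t x * j t x))
      ≤ μ ^ 2 * energyDensity V a t x + energyDensity V j t x := by
  unfold energyDensity
  nlinarith [sq_nonneg (μ * deriv (fun τ => a τ x) t - deriv (fun τ => j τ x) t),
    sq_nonneg (μ * deriv (a t) x - deriv (j t) x),
    mul_nonneg (hV0 x) (sq_nonneg (μ * a t x - j t x))]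

/-- The `t`-derivative slice `x ↦ ψ_t(t, x)` of a `C²` function is continuous. [folklore] -/
theorem continuous_deriv_slice_fst (hψ : ContDiff ℝ 2 (Function.uncurry ψ)) (t : ℝ) :
    Continuous (fun x => deriv (fun τ => ψ τ x) t) := by
  rw [show (fun x => deriv (fun τ => ψ τ x) t) = fun x => fderiv ℝ (Function.uncurry ψ) (t, x) (1, 0)
    from funext fun x => WaveEnergy.deriv_slice_fst_eq hψ t x]
  exact (WaveEnergy.continuous_fderiv_apply hψ (1, 0)).comp (Continuous.prodMk_right t)

/-- The pairing density `x ↦ a_t j_t + a_x j_x + V a j` at a fixed time is continuous. [folklore] -/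
theorem continuous_pairing (hV : Differentiable ℝ V) (ha : ContDiff ℝ 2 (Function.uncurry a))
    (hj : ContDiff ℝ 2 (Function.uncurry j)) (t : ℝ) :
    Continuous (fun x => deriv (fun τ => a τ x) t * deriv (fun τ => j τ x) t
        + deriv (a t) x * deriv (j t) x + V x * (a t x * j t x)) :=
  (((continuous_deriv_slice_fst ha t).mul (continuous_deriv_slice_fst hj t)).add
    (((contDiff_slice_snd ha t).continuous_deriv (by norm_num)).mul
      ((contDiff_slice_snd hj t).continuous_deriv (by norm_num)))).add
    (hV.continuous.mul ((contDiff_slice_snd ha t).continuous.mul (contDiff_slice_snd hj t).continuous))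

/-- A finite total energy makes the (continuous, nonnegative) energy density integrable. [folklore] -/
theorem integrable_energyDensity (hV : Differentiable ℝ V) (hV0 : ∀ x, 0 ≤ V x)
    (hψ : ContDiff ℝ 2 (Function.uncurry ψ)) {t : ℝ} (hE : totalEnergy V ψ t ≠ ⊤) :
    Integrable (fun x => energyDensity V ψ t x) := by
  refine ⟨(continuous_energyDensity_slice hV hψ t).aestronglyMeasurable, ?_⟩
  rw [hasFiniteIntegral_iff_ofReal (ae_of_all _ fun x => energyDensity_nonneg ψ t (hV0 x))]
  exact lt_top_iff_ne_top.2 hE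

/-- The Bochner integral of the energy density is the real part of the total energy. [folklore] -/
theorem integral_energyDensity_eq (hV : Differentiable ℝ V) (hV0 : ∀ x, 0 ≤ V x)
    (hψ : ContDiff ℝ 2 (Function.uncurry ψ)) (t : ℝ) :
    ∫ x, energyDensity V ψ t x = (totalEnergy V ψ t).toReal :=
  integral_eq_lintegral_of_nonneg_ae (ae_of_all _ fun x => energyDensity_nonneg ψ t (hV0 x))
    (continuous_energyDensity_slice hV hψ t).aestronglyMeasurable

/-- The pairing density of two finite-energy `C²` functions is integrable. [folklore] -/
theorem integrable_pairing (hV : Differentiable ℝ V) (hV0 : ∀ x, 0 ≤ V x)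
    (ha : ContDiff ℝ 2 (Function.uncurry a)) (hj : ContDiff ℝ 2 (Function.uncurry j)) (t : ℝ)
    (hea : Integrable (fun x => energyDensity V a t x))
    (hej : Integrable (fun x => energyDensity V j t x)) :
    Integrable (fun x => deriv (fun τ => a τ x) t * deriv (fun τ => j τ x) t
        + deriv (a t) x * deriv (j t) x + V x * (a t x * j t x)) := by
  have hg : Integrable (fun x => (energyDensity V a t x + energyDensity V j t x) / 2) :=
    (hea.add hej).div_const 2
  refine hg.mono' (continuous_pairing hV ha hj t).aestronglyMeasurable (ae_of_all _ fun x => ?_)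
  rw [Real.norm_eq_abs, abs_le]
  constructor <;> nlinarith [pairing_amgm hV0 a j t 1 x, pairing_amgm hV0 a j t (-1) x]

/-- The energy density of the sum of two finite-energy `C²` functions is integrable. [folklore] -/
theorem integrable_energyDensity_add (hV : Differentiable ℝ V) (hV0 : ∀ x, 0 ≤ V x)
    (ha : ContDiff ℝ 2 (Function.uncurry a)) (hj : ContDiff ℝ 2 (Function.uncurry j)) (t : ℝ)
    (hea : Integrable (fun x => energyDensity V a t x))
    (hej : Integrable (fun x => energyDensity V j t x)) :
    Integrable (fun x => energyDensity V (fun t x => a t x + j t x) t x) := by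
  have hg : Integrable (fun x => 2 * (energyDensity V a t x + energyDensity V j t x)) :=
    (hea.add hej).const_mul 2
  refine hg.mono' (continuous_energyDensity_slice (ψ := fun t x => a t x + j t x) hV (ha.add hj)
    t).aestronglyMeasurable (ae_of_all _ fun x => ?_)
  show ‖energyDensity V (fun t x => a t x + j t x) t x‖
    ≤ 2 * (energyDensity V a t x + energyDensity V j t x)
  rw [Real.norm_eq_abs, abs_of_nonneg (energyDensity_nonneg _ t (hV0 x)), energyDensity_add ha hj t x]
  nlinarith [pairing_amgm hV0 a j t 1 x]

/-- **The pairing as a polarised energy**: for two finite-energy global solutions,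
`∫ (a_t j_t + a_x j_x + V a j)(t, ·) = (E(a + j)(t) − E(a)(t) − E(j)(t)) / 2`. [folklore] -/
theorem integral_pairing_eq (hV : Differentiable ℝ V) (hV0 : ∀ x, 0 ≤ V x)
    (ha : IsSolution V a) (hj : IsSolution V j) {t : ℝ}
    (hEa : totalEnergy V a t ≠ ⊤) (hEj : totalEnergy V j t ≠ ⊤) :
    ∫ x, (deriv (fun τ => a τ x) t * deriv (fun τ => j τ x) t + deriv (a t) x * deriv (j t) x
        + V x * (a t x * j t x))
      = ((totalEnergy V (fun t x => a t x + j t x) t).toReal - (totalEnergy V a t).toReal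
          - (totalEnergy V j t).toReal) / 2 := by
  have hea := integrable_energyDensity hV hV0 ha.1 hEa
  have hej := integrable_energyDensity hV hV0 hj.1 hEj
  have hes := integrable_energyDensity_add hV hV0 ha.1 hj.1 t hea hej
  have hfun : (fun x => deriv (fun τ => a τ x) t * deriv (fun τ => j τ x) t
        + deriv (a t) x * deriv (j t) x + V x * (a t x * j t x))
      = fun x => (energyDensity V (fun t x => a t x + j t x) t x - energyDensity V a t x
          - energyDensity V j t x) / 2 := by
    funext x
    rw [energyDensity_add ha.1 hj.1 t x]
    ring
  have hd : Integrable (fun x => energyDensity V (fun t x => a t x + j t x) t x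
      - energyDensity V a t x) := hes.sub hea
  rw [hfun, integral_div, integral_sub hd hej, integral_sub hes hea,
    integral_energyDensity_eq (ψ := fun t x => a t x + j t x) hV hV0 (ha.1.add hj.1) t,
    integral_energyDensity_eq hV hV0 ha.1 t, integral_energyDensity_eq hV hV0 hj.1 t]

/-- If `2μ·c ≤ μ²F + G` for all real `μ` (`F ≥ 0`), then `c ≤ √F·√G` (discriminant). [folklore] -/
theorem le_sqrt_mul_sqrt_of_forall {F G c : ℝ} (hF : 0 ≤ F)
    (h : ∀ μ : ℝ, 2 * μ * c ≤ μ ^ 2 * F + G) : c ≤ √F * √G := by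
  have hd := discrim_le_zero (a := F) (b := -2 * c) (c := G) fun x => by nlinarith [h x]
  rw [← Real.sqrt_mul hF]
  exact Real.le_sqrt_of_sq_le (by rw [discrim] at hd; nlinarith [hd])

/-- **Cauchy–Schwarz under the integral sign** from the weighted polarisation inequality: if
`2μ·p ≤ μ²f + g` pointwise for all real `μ` (`f ≥ 0`; `f, g, p` integrable), then on every set `S`,
`∫_S p ≤ √(∫_S f)·√(∫_S g)`. [folklore] -/
theorem setIntegral_pairing_le {f g p : ℝ → ℝ} (hf : Integrable f) (hg : Integrable g)
    (hp : Integrable p) (hf0 : ∀ x, 0 ≤ f x)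
    (h : ∀ μ x, 2 * μ * p x ≤ μ ^ 2 * f x + g x) (S : Set ℝ) :
    ∫ x in S, p x ≤ √(∫ x in S, f x) * √(∫ x in S, g x) := by
  refine le_sqrt_mul_sqrt_of_forall (integral_nonneg hf0) fun μ => ?_
  have h1 : Integrable (fun x => 2 * μ * p x) (volume.restrict S) := hp.restrict.const_mul _
  have h2 : Integrable (fun x => μ ^ 2 * f x) (volume.restrict S) := hf.restrict.const_mul _
  calc 2 * μ * ∫ x in S, p x = ∫ x in S, 2 * μ * p x := (integral_const_mul _ _).symm
    _ ≤ ∫ x in S, (μ ^ 2 * f x + g x) := integral_mono h1 (h2.add hg.restrict) fun x => h μ x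
    _ = μ ^ 2 * (∫ x in S, f x) + ∫ x in S, g x := by
        rw [integral_add h2 hg.restrict, integral_const_mul]

/-- **The duality algebra**: `G = E(j)`; `Qf, Pf` / `Qg, Pg` the energies of `a` / `j` outside /
inside the cone; `Bo + Bi = G` the split pairing, `Bo ≤ √Qf √Qg`, `Bi ≤ √Pf √Pg`, `Qf ≤ A G`,
`Pf ≤ θ² G`, `Pg ≤ G`, `0 ≤ θ ≤ 1` ⟹ `((1 − θ)²/A)·G ≤ Qg`. [folklore] -/
theorem duality_algebra {G Qf Qg Pf Pg Bo Bi A θ : ℝ} (hA : 0 < A) (hθ0 : 0 ≤ θ)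
    (hθ1 : θ ≤ 1) (hG0 : 0 ≤ G) (hQg0 : 0 ≤ Qg)
    (hBo : Bo ≤ √Qf * √Qg) (hBi : Bi ≤ √Pf * √Pg) (hsplit : Bo + Bi = G)
    (hQf : Qf ≤ A * G) (hPf : Pf ≤ θ ^ 2 * G) (hPg : Pg ≤ G) :
    (1 - θ) ^ 2 / A * G ≤ Qg := by
  have h1 : √Qf ≤ √A * √G := by
    rw [← Real.sqrt_mul hA.le]
    exact Real.sqrt_le_sqrt hQf
  have h2 : √Pf * √Pg ≤ θ * G := by
    have h21 : √Pf ≤ θ * √G := by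
      calc √Pf ≤ √(θ ^ 2 * G) := Real.sqrt_le_sqrt hPf
        _ = θ * √G := by rw [Real.sqrt_mul (sq_nonneg θ), Real.sqrt_sq hθ0]
    calc √Pf * √Pg ≤ θ * √G * √G :=
          mul_le_mul h21 (Real.sqrt_le_sqrt hPg) (Real.sqrt_nonneg _) (by positivity)
      _ = θ * G := by rw [mul_assoc, Real.mul_self_sqrt hG0]
  have hmain : (1 - θ) * G ≤ √A * √G * √Qg := by
    have h3 := calc G = Bo + Bi := hsplit.symm
      _ ≤ √Qf * √Qg + √Pf * √Pg := add_le_add hBo hBi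
      _ ≤ √A * √G * √Qg + θ * G :=
          add_le_add (mul_le_mul_of_nonneg_right h1 (Real.sqrt_nonneg _)) h2
    linarith
  rcases hG0.eq_or_lt with hG | hGpos
  · rw [← hG, mul_zero]
    exact hQg0
  have h5 := mul_self_le_mul_self (mul_nonneg (by linarith) hG0) hmain
  have e : √A * √G * √Qg * (√A * √G * √Qg) = A * G * Qg := by
    linear_combination (√G * √G * (√Qg * √Qg)) * Real.mul_self_sqrt hA.le
      + (A * (√Qg * √Qg)) * Real.mul_self_sqrt hG0 + (A * G) * Real.mul_self_sqrt hQg0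
  rw [e] at h5
  have h6 : (1 - θ) ^ 2 * G ≤ A * Qg := by
    refine le_of_mul_le_mul_left ?_ hGpos
    nlinarith [h5]
  rw [div_mul_eq_mul_div, div_le_iff₀ hA]
  linarith [h6]

/-- **Duality at a fixed time, real form**: `f = e[a](t, ·)`, `g = e[j](t, ·)`, `p` the pairing
density, `S` the exterior of the cone; `∫ p = ∫ g`, `∫ f ≤ A ∫ g`, `∫ f ≤ ∫_S f + θ² ∫ g`
⟹ `((1 − θ)²/A) ∫ g ≤ ∫_S g`. [folklore] -/
theorem duality_real {f g p : ℝ → ℝ} (hf : Integrable f) (hg : Integrable g)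
    (hp : Integrable p) (hf0 : ∀ x, 0 ≤ f x) (hg0 : ∀ x, 0 ≤ g x)
    (hpt : ∀ μ x, 2 * μ * p x ≤ μ ^ 2 * f x + g x)
    {S : Set ℝ} (hS : MeasurableSet S) {A θ : ℝ} (hA : 0 < A) (hθ0 : 0 ≤ θ) (hθ1 : θ ≤ 1)
    (hpair : ∫ x, p x = ∫ x, g x) (hAE : ∫ x, f x ≤ A * ∫ x, g x)
    (hloss : ∫ x, f x ≤ (∫ x in S, f x) + θ ^ 2 * ∫ x, g x) :
    (1 - θ) ^ 2 / A * ∫ x, g x ≤ ∫ x in S, g x := by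
  have hQPf : (∫ x in S, f x) + ∫ x in Sᶜ, f x = ∫ x, f x := integral_add_compl hS hf
  have hQPg : (∫ x in S, g x) + ∫ x in Sᶜ, g x = ∫ x, g x := integral_add_compl hS hg
  have hQPp : (∫ x in S, p x) + ∫ x in Sᶜ, p x = ∫ x, p x := integral_add_compl hS hp
  have hPf0 : 0 ≤ ∫ x in Sᶜ, f x := integral_nonneg hf0
  have hQg0 : 0 ≤ ∫ x in S, g x := integral_nonneg hg0
  exact duality_algebra hA hθ0 hθ1 (integral_nonneg hg0) hQg0
    (setIntegral_pairing_le hf hg hp hf0 hpt S) (setIntegral_pairing_le hf hg hp hf0 hpt Sᶜ)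
    (by rw [hQPp, hpair]) (by linarith) (by linarith) (by linarith)

/-- **Duality at a fixed time `t ≥ max 0 (−b)`**: under the hypotheses of `stub_duality`,
`((1 − θ)²/A)·E(j) ≤ E_ext^{0,b}(j)(t)`. [folklore] -/
theorem key_step (hV : Differentiable ℝ V) (hV0 : ∀ x, 0 ≤ V x)
    (ha : IsSolution V a) (hj : IsSolution V j)
    (hEa : totalEnergy V a 0 ≠ ⊤) (hEj : totalEnergy V j 0 ≠ ⊤) {A θ b : ℝ} (hA : 0 < A)
    (hθ0 : 0 ≤ θ) (hθ1 : θ ≤ 1)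
    (hpair : ∫ x, (deriv (fun τ => a τ x) 0 * deriv (fun τ => j τ x) 0 + deriv (a 0) x * deriv (j 0) x
        + V x * (a 0 x * j 0 x)) = (totalEnergy V j 0).toReal)
    (hAE : totalEnergy V a 0 ≤ ENNReal.ofReal A * totalEnergy V j 0)
    (hloss : totalEnergy V a 0
      ≤ channelEnergy V 0 b a atTop + ENNReal.ofReal (θ ^ 2) * totalEnergy V j 0)
    {t : ℝ} (ht : 0 ≤ t) (hbt : 0 ≤ b + t) :
    ENNReal.ofReal ((1 - θ) ^ 2 / A) * totalEnergy V j 0 ≤ exteriorEnergy V 0 b j t := by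
  have hEat : totalEnergy V a t = totalEnergy V a 0 := totalEnergy_eq_totalEnergy hV hV0 ha t 0
  have hEjt : totalEnergy V j t = totalEnergy V j 0 := totalEnergy_eq_totalEnergy hV hV0 hj t 0
  have hEat' : totalEnergy V a t ≠ ⊤ := by rwa [hEat]
  have hEjt' : totalEnergy V j t ≠ ⊤ := by rwa [hEjt]
  have hS : MeasurableSet {x : ℝ | b + |t| < |x - 0|} :=
    (isOpen_lt continuous_const (by fun_prop)).measurableSet
  have hea := integrable_energyDensity hV hV0 ha.1 hEat'
  have hej := integrable_energyDensity hV hV0 hj.1 hEjt'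
  have hI : ∀ {φ : ℝ → ℝ → ℝ}, IsSolution V φ →
      ∫ x, energyDensity V φ t x = (totalEnergy V φ 0).toReal := fun hφ => by
    rw [integral_energyDensity_eq hV hV0 hφ.1, totalEnergy_eq_totalEnergy hV hV0 hφ t 0]
  have hpair' : ∫ x, (deriv (fun τ => a τ x) t * deriv (fun τ => j τ x) t
        + deriv (a t) x * deriv (j t) x + V x * (a t x * j t x))
      = ∫ x, energyDensity V j t x := by
    rw [hI hj, integral_pairing_eq hV hV0 ha hj hEat' hEjt',
      totalEnergy_eq_totalEnergy hV hV0 (isSolution_add ha hj) t 0, hEat, hEjt,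
      ← integral_pairing_eq hV hV0 ha hj hEa hEj]
    exact hpair
  have hAE' : ∫ x, energyDensity V a t x ≤ A * ∫ x, energyDensity V j t x := by
    rw [hI ha, hI hj]
    have h1 := ENNReal.toReal_mono (ENNReal.mul_ne_top ENNReal.ofReal_ne_top hEj) hAE
    rwa [ENNReal.toReal_mul, ENNReal.toReal_ofReal hA.le] at h1
  have hQ : ∀ {φ : ℝ → ℝ → ℝ}, Integrable (fun x => energyDensity V φ t x) →
      exteriorEnergy V 0 b φ t
        = ENNReal.ofReal (∫ x in {x : ℝ | b + |t| < |x - 0|}, energyDensity V φ t x) := fun {φ} hφ => by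
    unfold exteriorEnergy
    exact (ofReal_integral_eq_lintegral_ofReal hφ.restrict
      (ae_of_all _ fun x => energyDensity_nonneg φ t (hV0 x))).symm
  have hloss' : ∫ x, energyDensity V a t x
      ≤ (∫ x in {x : ℝ | b + |t| < |x - 0|}, energyDensity V a t x)
        + θ ^ 2 * ∫ x, energyDensity V j t x := by
    rw [hI ha, hI hj]
    have hch := WindowedShellChannels.Negative.channelEnergy_atTop_le_exteriorEnergy hV hV0 ha 0 b ht hbt
    have h1 : totalEnergy V a 0
        ≤ ENNReal.ofReal (∫ x in {x : ℝ | b + |t| < |x - 0|}, energyDensity V a t x)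
          + ENNReal.ofReal (θ ^ 2) * totalEnergy V j 0 :=
      hloss.trans (add_le_add (hch.trans (hQ hea).le) le_rfl)
    have hne : ENNReal.ofReal (∫ x in {x : ℝ | b + |t| < |x - 0|}, energyDensity V a t x)
        + ENNReal.ofReal (θ ^ 2) * totalEnergy V j 0 ≠ ⊤ :=
      ENNReal.add_ne_top.2 ⟨ENNReal.ofReal_ne_top, ENNReal.mul_ne_top ENNReal.ofReal_ne_top hEj⟩
    have h2 := ENNReal.toReal_mono hne h1
    rwa [ENNReal.toReal_add ENNReal.ofReal_ne_top (ENNReal.mul_ne_top ENNReal.ofReal_ne_top hEj),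
      ENNReal.toReal_ofReal (setIntegral_nonneg hS fun x _ => energyDensity_nonneg a t (hV0 x)),
      ENNReal.toReal_mul, ENNReal.toReal_ofReal (sq_nonneg θ)] at h2
  have key := duality_real hea hej (integrable_pairing hV hV0 ha.1 hj.1 t hea hej)
    (fun x => energyDensity_nonneg a t (hV0 x)) (fun x => energyDensity_nonneg j t (hV0 x))
    (fun μ x => pairing_amgm hV0 a j t μ x) hS hA hθ0 hθ1 hpair' hAE' hloss'
  rw [hQ hej, ← ENNReal.ofReal_toReal hEj, ← hI hj, ← ENNReal.ofReal_mul (by positivity)]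
  exact ENNReal.ofReal_le_ofReal key

end Duality

/-- **Completion duality for two finite-energy solutions** of `ψ_tt − ψ_xx + Vψ = 0`, `V ≥ 0`
differentiable (registered stub `stub_duality`, line `SketchIdeator3`, crux `WindowedShellChannels`):
if the energy pairing of `a` and `j` at `t = 0` equals `E(j)`, `E(a) ≤ A·E(j)`, and `a` loses at
most `θ²E(j)` behind the (possibly lagged, `b < 0`) forward cone `{b + |t| < |x|}`, then `j`
radiates at least `((1 − θ)²/A)·E(j)` ahead of the same cone (`Duality.key_step`, `liminf`). [folklore] -/
theorem stub_duality :
    ∀ (V : ℝ → ℝ), Differentiable ℝ V → (∀ x, 0 ≤ V x) →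
    ∀ (a j : ℝ → ℝ → ℝ), IsSolution V a → IsSolution V j →
    totalEnergy V a 0 ≠ ⊤ → totalEnergy V j 0 ≠ ⊤ →
    ∀ (A θ b : ℝ), 0 < A → 0 ≤ θ → θ < 1 →
    (∫ x, (deriv (fun τ => a τ x) 0 * deriv (fun τ => j τ x) 0 + deriv (a 0) x * deriv (j 0) x
        + V x * (a 0 x * j 0 x))) = (totalEnergy V j 0).toReal →
    totalEnergy V a 0 ≤ ENNReal.ofReal A * totalEnergy V j 0 →
    totalEnergy V a 0 ≤ channelEnergy V 0 b a atTop + ENNReal.ofReal (θ ^ 2) * totalEnergy V j 0 →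
    ENNReal.ofReal ((1 - θ) ^ 2 / A) * totalEnergy V j 0 ≤ channelEnergy V 0 b j atTop := by
  intro V hV hV0 a j ha hj hEa hEj A θ b hA hθ0 hθ1 hpair hAE hloss
  unfold channelEnergy
  refine le_liminf_of_le (by isBoundedDefault) ?_
  filter_upwards [eventually_ge_atTop (max 0 (-b))] with t ht
  exact Duality.key_step hV hV0 ha hj hEa hEj hA hθ0 hθ1.le hpair hAE hloss (le_of_max_le_left ht)
    (by linarith [le_of_max_le_right ht])

end Summit.FinalStateConjecture.FinalStateConjecture.Theorems.WindowedShellChannelsStubs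

end
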